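import Mathlib.Analysis.SpecialFunctions.Complex.LogBounds
import Mathlib.Analysis.SpecialFunctions.Trigonometric.Series
import Literature.NumberTheory.LFunctions.EquivalentsKeiperLiProofs
import Literature.NumberTheory.LFunctions.ZetaZerosReflection
import Literature.NumberTheory.DiophantineGeometry.NamedHypothesesProofs
import HarnessLib

/-!
# Partial Keiper–Li positivity from a verified height of the Riemann hypothesis

Li's criterion (tree: `li_criterion_holds`) says `RH ↔ λₙ ≥ 0` for all `n ≥ 1`, where
`λₙ = keiperLiCoeff n` are the Keiper–Li coefficients. This file proves the *partial* statement
that a verified initial segment of the critical line already forces an initial segment of the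
coefficients to be non-negative — the case `ζ` and the sub-range `n ≤ 2π(T − 4)` of F. Brown,
J. Number Theory 111 (2005), Theorem 2 (printed range `n ≤ 2T² log T`, whose proof beyond the
linear range is reported as incomplete, see "Context") — with a range **linear** in the height:

* `keiperLiCoeff_nonneg_of_riemannHypothesisUpTo`: if every zero `ρ` of `ζ` with `0 < Im ρ ≤ T`
  has `Re ρ = 1/2` (`RiemannHypothesisUpTo T`), then `λₙ ≥ 0` for every `1 ≤ n ≤ 2π(T − 4)`;
* `keiperLiCoeff_nonneg_of_plattTrudgian`: with the Platt–Trudgian height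
  `T = 3 000 175 332 800` (named hypothesis `riemannHypothesisUpTo_platt_trudgian`, Bull. LMS 53
  (2021), Thm. 1) this gives `λₙ ≥ 0` for all `1 ≤ n ≤ 1.885 · 10¹³`.

For comparison, the largest table of Keiper–Li coefficients computed with certified error bounds
reaches `n = 10⁵` (F. Johansson, Numer. Algorithms 69 (2015), §4.2).

## Proof

By the zero-sum formula `λₙ = lim_{T' → ∞} ∑_{ρ ∈ liZeroBox T'} m(ρ) [1 − (1 − 1/ρ)ⁿ]`
(`keiperLiCoeff_eq_zero_sum_holds`) it suffices to show that the real part of every box sum is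
`≥ 0`. The boxes are stable under the reflection `ρ ↦ 1 − ρ̄`, which preserves multiplicities
(`riemannZetaZeroOrder_one_sub_conj`), so twice the box sum is the sum over `ρ` of the pair terms
`m(ρ) [2 − Re (1 − 1/ρ)ⁿ − Re (1 − 1/(1 − ρ̄))ⁿ]`. For a zero on the critical line both real parts
are `≤ 1` since `|1 − 1/ρ| = 1` (Li 1997, p. 328; tree `norm_one_sub_inv_eq_one`). For a zero
`ρ = β + iγ` with `|γ| > T`, write `1 − 1/ρ = e^{L}` with `L = log(1 − 1/ρ) = −1/ρ + E`,
`‖E‖ ≤ (2/3)/|ρ|²`; then `1 − 1/(1 − ρ̄) = conj (e^{−L})` and the pair term is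
`m(ρ) · 2 (1 − cosh x cos y)` with `x + iy = nL`, where `|x| ≤ (5/3) n/|ρ|²` and
`|y − nγ/|ρ|²| ≤ (2/3) n/|ρ|²`. The elementary inequality `cosh x · cos y ≤ 1` for
`|x| ≤ 1`, `|x| ≤ (9/10)|y|`, `|y| + (10/9)|x| ≤ 2π` (`cosh_mul_cos_le_one`, from the Taylor bounds
`Real.cos_bound`, `Real.cosh_le_exp_half_sq`) finishes the proof as soon as `n ≤ 2π(|γ| − 4)`.

## Context (not used in the proofs)

The range is linear in `T` because the argument is termwise. A. Palojärvi, *Explicit zero-free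
regions and a τ-Li-type criterion*, Alb. J. Math. 14 (2020), Thm. 3.3, proves by a different
bookkeeping a statement of the same type with range `n ≤ T/(eτ)` under a lens hypothesis on all
zeros; F. Brown, J. Number Theory 111 (2005), Thm. 2 asserted `n ≤ 2T² log T`, but that proof is
reported as incomplete by Palojärvi (loc. cit., §1); J. Oesterlé's range `n ≤ T²` (2000) is
unpublished (reported in Biane–Pitman–Yor, Bull. AMS 38 (2001), p. 441). A quadratic range needs
zero counting above `T` and is deliberately NOT attempted here. No new named fact is introduced.
-/

noncomputable section

open Complex Filter Set
open scoped Real ComplexConjugate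

namespace Literature.NumberTheory.LFunctions

open _root_.Topology

/-! ## The trigonometric inequality -/

/-- For `|x| ≤ 1`, `0 ≤ d ≤ π` and `|x| ≤ (9/10) d` one has `cosh x · cos d ≤ 1`: for `d ≤ 1`,
`cos d ≤ 1 − (43/96) d²` (`Real.cos_bound`) and `cosh x ≤ exp(x²/2) ≤ 1/(1 − x²/2)`; for
`1 ≤ d ≤ π`, `cos d ≤ cos 1 ≤ 53/96` and `cosh x ≤ exp(1/2) ≤ 33/20`. [folklore] -/
private theorem cosh_mul_cos_le_one_of_le {x d : ℝ} (hx1 : |x| ≤ 1) (hd0 : 0 ≤ d) (hdπ : d ≤ π)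
    (hxd : |x| ≤ 9 / 10 * d) : Real.cosh x * Real.cos d ≤ 1 := by
  by_cases hc : Real.cos d ≤ 0
  · nlinarith [Real.cosh_pos x]
  rw [not_le] at hc
  have hx2 : x ^ 2 ≤ 1 := by
    have h : |x| ^ 2 ≤ 1 ^ 2 := pow_le_pow_left₀ (abs_nonneg x) hx1 2
    simpa [sq_abs] using h
  have hcosh : Real.cosh x ≤ Real.exp (x ^ 2 / 2) := Real.cosh_le_exp_half_sq x
  by_cases hd1 : d ≤ 1
  · have hcb := Real.cos_bound (x := d) (by rwa [abs_of_nonneg hd0])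
    rw [abs_of_nonneg hd0] at hcb
    have hd4 : d ^ 4 ≤ d ^ 2 := by
      have hd2 : d ^ 2 ≤ 1 := by nlinarith
      nlinarith [mul_le_mul_of_nonneg_left hd2 (sq_nonneg d)]
    have hcos : Real.cos d ≤ 1 - 43 / 96 * d ^ 2 := by
      have h := (abs_le.1 hcb).2
      linarith
    have hexp : Real.exp (x ^ 2 / 2) ≤ 1 / (1 - x ^ 2 / 2) :=
      Real.exp_bound_div_one_sub_of_interval (by positivity) (by linarith)
    have hxd2 : x ^ 2 ≤ 81 / 100 * d ^ 2 := by
      have h : |x| ^ 2 ≤ (9 / 10 * d) ^ 2 := pow_le_pow_left₀ (abs_nonneg x) hxd 2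
      rw [sq_abs] at h
      nlinarith
    have hpos : 0 < 1 - x ^ 2 / 2 := by linarith
    calc Real.cosh x * Real.cos d ≤ (1 / (1 - x ^ 2 / 2)) * (1 - 43 / 96 * d ^ 2) :=
          mul_le_mul (hcosh.trans hexp) hcos hc.le (div_nonneg zero_le_one hpos.le)
      _ ≤ 1 := by
          rw [div_mul_eq_mul_div, one_mul, div_le_one hpos]
          nlinarith [sq_nonneg d]
  · rw [not_le] at hd1
    have hcos1 : Real.cos d ≤ Real.cos 1 :=
      Real.cos_le_cos_of_nonneg_of_le_pi (by norm_num) hdπ hd1.le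
    have hcb := Real.cos_bound (x := (1 : ℝ)) (by norm_num)
    have hc1 : Real.cos 1 ≤ 53 / 96 := by
      have h := (abs_le.1 hcb).2
      norm_num at h
      linarith
    have hexp : Real.exp (x ^ 2 / 2) ≤ Real.exp (1 / 2) := Real.exp_le_exp.2 (by linarith)
    have hsq : Real.exp (1 / 2) * Real.exp (1 / 2) = Real.exp 1 := by
      rw [← Real.exp_add]
      norm_num
    have he : Real.exp (1 / 2 : ℝ) ≤ 33 / 20 := by
      nlinarith [Real.exp_one_lt_d9, Real.exp_pos (1 / 2 : ℝ)]
    calc Real.cosh x * Real.cos d ≤ (33 / 20) * (53 / 96) :=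
          mul_le_mul ((hcosh.trans hexp).trans he) (hcos1.trans hc1) hc.le (by norm_num)
      _ ≤ 1 := by norm_num

/-- `cosh x · cos y ≤ 1` whenever `|x| ≤ 1`, `|x| ≤ (9/10)|y|` and `|y| + (10/9)|x| ≤ 2π`: if
`|y| ≤ π/2` or `|y| ≥ 3π/2` this is `cosh_mul_cos_le_one_of_le` with `d = |y|` resp.
`d = 2π − |y|`, and in between `cos y ≤ 0`. [folklore] -/
private theorem cosh_mul_cos_le_one {x y : ℝ} (hx1 : |x| ≤ 1) (hxy : |x| ≤ 9 / 10 * |y|)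
    (hy : |y| + 10 / 9 * |x| ≤ 2 * π) : Real.cosh x * Real.cos y ≤ 1 := by
  wlog hy0 : 0 ≤ y generalizing y
  · rw [not_le] at hy0
    have h := this (y := -y) (by simpa using hxy) (by simpa using hy) (by linarith)
    simpa [Real.cos_neg] using h
  rw [abs_of_nonneg hy0] at hxy hy
  rcases le_or_gt y (π / 2) with h1 | h1
  · exact cosh_mul_cos_le_one_of_le hx1 hy0 (by linarith [Real.pi_pos]) hxy
  rcases le_or_gt y (π + π / 2) with h2 | h2
  · have hc : Real.cos y ≤ 0 := Real.cos_nonpos_of_pi_div_two_le_of_le h1.le h2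
    nlinarith [Real.cosh_pos x]
  · have hd0 : 0 ≤ 2 * π - y := by linarith [abs_nonneg x]
    rw [← Real.cos_two_pi_sub]
    exact cosh_mul_cos_le_one_of_le hx1 hd0 (by linarith [Real.pi_pos]) (by linarith)

/-! ## The pair term of an off-line zero far up the strip -/

/-- Algebra of the reflection `z ↦ 1 − z̄` on the Li variable: `1 − 1/(1 − z) = (1 − z⁻¹)⁻¹` for
`z ≠ 0, 1`. [folklore] -/
private theorem one_sub_one_div_one_sub_eq {z : ℂ} (hz0 : z ≠ 0) (hz1 : z ≠ 1) :
    1 - 1 / (1 - z) = (1 - z⁻¹)⁻¹ := by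
  have h1 : (1 : ℂ) - z ≠ 0 := sub_ne_zero.2 (Ne.symm hz1)
  have h2 : z - 1 ≠ 0 := sub_ne_zero.2 hz1
  rw [show (1 : ℂ) - z⁻¹ = (z - 1) / z by field_simp, inv_div]
  field_simp
  ring

/-- **Pair inequality.** For `ρ = β + iγ` with `0 ≤ β ≤ 1` and `n ≤ 2π(|γ| − 4)`,
`Re (1 − 1/ρ)ⁿ + Re (1 − 1/(1 − ρ̄))ⁿ ≤ 2`. Writing `1 − 1/ρ = e^{L}` with `L = log(1 − 1/ρ)`,
the left side is `2 cosh(n Re L) cos(n Im L)`, and `L = −1/ρ + E` with `‖E‖ ≤ (2/3)/|ρ|²`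
(`Complex.norm_log_one_add_sub_self_le`) puts `x = n Re L`, `y = n Im L` in the range of
`cosh_mul_cos_le_one`. [folklore] -/
private theorem re_pow_add_re_pow_reflect_le_two {ρ : ℂ} (h0 : 0 ≤ ρ.re) (h1 : ρ.re ≤ 1) {n : ℕ}
    (hn : (n : ℝ) ≤ 2 * π * (|ρ.im| - 4)) :
    ((1 - 1 / ρ) ^ n).re + ((1 - 1 / (1 - conj ρ)) ^ n).re ≤ 2 := by
  rcases Nat.eq_zero_or_pos n with rfl | hn0
  · norm_num
  have hn1 : (1 : ℝ) ≤ n := by exact_mod_cast hn0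
  have hγ4 : 4 < |ρ.im| := by
    by_contra h
    rw [not_lt] at h
    have h' := mul_le_mul_of_nonneg_left h Real.pi_pos.le
    linarith
  have him0 : ρ.im ≠ 0 := by
    intro h
    rw [h, abs_zero] at hγ4
    linarith
  have hρ0 : ρ ≠ 0 := fun h ↦ him0 (by simp [h])
  have hρ1 : ρ ≠ 1 := fun h ↦ him0 (by simp [h])
  -- the norm square `N = |ρ|²`
  obtain ⟨N, hN⟩ : ∃ N : ℝ, Complex.normSq ρ = N := ⟨_, rfl⟩
  have hNeq : N = ρ.re ^ 2 + ρ.im ^ 2 := by rw [← hN, Complex.normSq_apply]; ring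
  have hγ2 : 16 < ρ.im ^ 2 := by
    have h := mul_lt_mul'' hγ4 hγ4 (by norm_num) (by norm_num)
    nlinarith [sq_abs ρ.im]
  have hNγ : ρ.im ^ 2 ≤ N := by rw [hNeq]; nlinarith
  have hNpos : 0 < N := by linarith
  -- `ε = ρ⁻¹`
  have hεsq : ‖ρ⁻¹‖ ^ 2 = N⁻¹ := by rw [Complex.sq_norm, Complex.normSq_inv, hN]
  have hε2le : ‖ρ⁻¹‖ ^ 2 ≤ 1 / 16 := by
    rw [hεsq, one_div, inv_le_inv₀ hNpos (by norm_num)]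
    linarith
  have hεle : ‖ρ⁻¹‖ ≤ 1 / 4 := by nlinarith [norm_nonneg ρ⁻¹]
  have hεlt1 : ‖ρ⁻¹‖ < 1 := by linarith
  have hw0 : (1 : ℂ) - ρ⁻¹ ≠ 0 := by
    intro h
    have h' : ‖(ρ⁻¹ : ℂ)‖ = 1 := by rw [← sub_eq_zero.1 h]; simp
    linarith
  obtain ⟨L, hL⟩ : ∃ L : ℂ, Complex.log (1 - ρ⁻¹) = L := ⟨_, rfl⟩
  have hexpL : Complex.exp L = 1 - ρ⁻¹ := by rw [← hL]; exact Complex.exp_log hw0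
  have hwn : (1 - 1 / ρ) ^ n = Complex.exp (n * L) := by
    rw [Complex.exp_nat_mul, hexpL, one_div]
  have hc0 : conj ρ ≠ 0 := fun h ↦ hρ0 (by simpa using congrArg conj h)
  have hc1 : conj ρ ≠ 1 := fun h ↦ hρ1 (by simpa using congrArg conj h)
  have hw'n : (1 - 1 / (1 - conj ρ)) ^ n = conj (Complex.exp (-(n * L))) := by
    rw [Complex.exp_neg, Complex.exp_nat_mul, hexpL, map_inv₀, map_pow, map_sub, map_one,
      map_inv₀, ← inv_pow, one_sub_one_div_one_sub_eq hc0 hc1]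
  -- real parts
  have hnL_re : ((n : ℂ) * L).re = n * L.re := by simp [Complex.mul_re]
  have hnL_im : ((n : ℂ) * L).im = n * L.im := by simp [Complex.mul_im]
  have hre1 : ((1 - 1 / ρ) ^ n).re = Real.exp (n * L.re) * Real.cos (n * L.im) := by
    rw [hwn, Complex.exp_re, hnL_re, hnL_im]
  have hre2 : ((1 - 1 / (1 - conj ρ)) ^ n).re =
      Real.exp (-(n * L.re)) * Real.cos (n * L.im) := by
    rw [hw'n, Complex.conj_re, Complex.exp_re, Complex.neg_re, Complex.neg_im, hnL_re, hnL_im,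
      Real.cos_neg]
  rw [hre1, hre2]
  obtain ⟨x, hx⟩ : ∃ x : ℝ, (n : ℝ) * L.re = x := ⟨_, rfl⟩
  obtain ⟨y, hy⟩ : ∃ y : ℝ, (n : ℝ) * L.im = y := ⟨_, rfl⟩
  rw [hx, hy]
  have hsum : Real.exp x * Real.cos y + Real.exp (-x) * Real.cos y =
      2 * (Real.cosh x * Real.cos y) := by
    rw [Real.cosh_eq]
    ring
  rw [hsum]
  suffices h : Real.cosh x * Real.cos y ≤ 1 by linarith
  -- the logarithm: `L = -ρ⁻¹ + E`, `‖E‖ ≤ (2/3) N⁻¹`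
  have hE : ‖L + ρ⁻¹‖ ≤ 2 / 3 * N⁻¹ := by
    have h := Complex.norm_log_one_add_sub_self_le (z := -ρ⁻¹) (by rwa [norm_neg])
    rw [norm_neg, ← sub_eq_add_neg, hL, sub_neg_eq_add] at h
    have hinv : (1 - ‖(ρ⁻¹ : ℂ)‖)⁻¹ ≤ 4 / 3 := by
      have h43 : (4 / 3 : ℝ)⁻¹ = 3 / 4 := by norm_num
      rw [inv_le_comm₀ (by linarith) (by norm_num), h43]
      linarith
    calc ‖L + ρ⁻¹‖ ≤ ‖(ρ⁻¹ : ℂ)‖ ^ 2 * (1 - ‖(ρ⁻¹ : ℂ)‖)⁻¹ / 2 := h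
      _ ≤ ‖(ρ⁻¹ : ℂ)‖ ^ 2 * (4 / 3) / 2 := by gcongr
      _ = 2 / 3 * N⁻¹ := by rw [hεsq]; ring
  have hLre : |L.re| ≤ 5 / 3 * N⁻¹ := by
    have h1' : |(L + ρ⁻¹).re| ≤ 2 / 3 * N⁻¹ := (Complex.abs_re_le_norm _).trans hE
    rw [Complex.add_re, Complex.inv_re, hN] at h1'
    have h2 : 0 ≤ ρ.re / N := div_nonneg h0 hNpos.le
    have h3 : ρ.re / N ≤ N⁻¹ := by
      rw [div_le_iff₀ hNpos, inv_mul_cancel₀ hNpos.ne']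
      exact h1
    have h4 := abs_le.1 h1'
    rw [abs_le]
    constructor <;> linarith [h4.1, h4.2]
  have hLim : |L.im - ρ.im / N| ≤ 2 / 3 * N⁻¹ := by
    have h1' : |(L + ρ⁻¹).im| ≤ 2 / 3 * N⁻¹ := (Complex.abs_im_le_norm _).trans hE
    rwa [Complex.add_im, Complex.inv_im, hN, neg_div, ← sub_eq_add_neg] at h1'
  -- the sizes of `x` and `y` in terms of `u = n / N`
  have hn0' : (0 : ℝ) ≤ n := n.cast_nonneg
  obtain ⟨u, hu⟩ : ∃ u : ℝ, (n : ℝ) / N = u := ⟨_, rfl⟩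
  have hu0 : 0 ≤ u := by rw [← hu]; positivity
  have huN : u * N = n := by rw [← hu, div_mul_cancel₀ _ hNpos.ne']
  have hxb : |x| ≤ 5 / 3 * u := by
    rw [← hx, abs_mul, Nat.abs_cast, ← hu]
    calc (n : ℝ) * |L.re| ≤ n * (5 / 3 * N⁻¹) := mul_le_mul_of_nonneg_left hLre hn0'
      _ = 5 / 3 * (n / N) := by ring
  have hyb : |y - ρ.im * u| ≤ 2 / 3 * u := by
    have h : y - ρ.im * u = n * (L.im - ρ.im / N) := by rw [← hy, ← hu]; ring
    rw [h, abs_mul, Nat.abs_cast, ← hu]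
    calc (n : ℝ) * |L.im - ρ.im / N| ≤ n * (2 / 3 * N⁻¹) := mul_le_mul_of_nonneg_left hLim hn0'
      _ = 2 / 3 * (n / N) := by ring
  have hγu : |ρ.im * u| = |ρ.im| * u := by rw [abs_mul, abs_of_nonneg hu0]
  -- `|y|` is within `(2/3) u` of `|γ| u`
  have hy_up : |y| ≤ |ρ.im| * u + 2 / 3 * u := by
    have h := abs_sub_abs_le_abs_sub y (ρ.im * u)
    rw [hγu] at h
    linarith
  have hy_low : |ρ.im| * u - 2 / 3 * u ≤ |y| := by
    have h := abs_sub_abs_le_abs_sub (ρ.im * u) y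
    rw [hγu, abs_sub_comm] at h
    linarith
  -- (a) `(5/3) u ≤ 1`, from `n ≤ 2π(|γ| − 4) ≤ (3/5) γ² ≤ (3/5) N`
  have hπ := Real.pi_lt_d2
  have hsq : |ρ.im| ^ 2 = ρ.im ^ 2 := sq_abs ρ.im
  have ha : 5 / 3 * u ≤ 1 := by
    have h2π : 2 * π ≤ 63 / 10 := by linarith
    have hlin : (n : ℝ) ≤ 63 / 10 * (|ρ.im| - 4) :=
      hn.trans (mul_le_mul_of_nonneg_right h2π (by linarith))
    have h : 5 / 3 * (n : ℝ) ≤ N := by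
      linarith [sq_nonneg (|ρ.im| - 21 / 4)]
    have h3 : 5 / 3 * u * N ≤ 1 * N := by
      rw [one_mul, mul_assoc, huN]
      exact h
    exact le_of_mul_le_mul_right h3 hNpos
  -- (b) `(5/3) u ≤ (9/10) |y|`
  have hb : 5 / 3 * u ≤ 9 / 10 * |y| := by
    have hγu4 : 4 * u ≤ |ρ.im| * u := mul_le_mul_of_nonneg_right hγ4.le hu0
    linarith
  -- (c) `|y| + (10/9)|x| ≤ 2π`
  have hc : |y| + 10 / 9 * |x| ≤ 2 * π := by
    have h' : (|ρ.im| + 68 / 27) * (n : ℝ) ≤ (|ρ.im| + 68 / 27) * (2 * π * (|ρ.im| - 4)) :=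
      mul_le_mul_of_nonneg_left hn (by positivity)
    have hexpand : (|ρ.im| + 68 / 27) * (2 * π * (|ρ.im| - 4)) ≤ 2 * π * |ρ.im| ^ 2 := by
      linarith [mul_nonneg Real.pi_pos.le (abs_nonneg ρ.im), Real.pi_pos]
    have h2πN : 2 * π * |ρ.im| ^ 2 ≤ 2 * π * N := by
      rw [hsq]
      exact mul_le_mul_of_nonneg_left hNγ (by positivity)
    have h : (|ρ.im| + 68 / 27) * (n : ℝ) ≤ 2 * π * N := h'.trans (hexpand.trans h2πN)
    have h'' : (|ρ.im| + 68 / 27) * u ≤ 2 * π := by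
      rw [← huN] at h
      have h3 : (|ρ.im| + 68 / 27) * u * N ≤ 2 * π * N := by linarith
      exact le_of_mul_le_mul_right h3 hNpos
    linarith
  exact cosh_mul_cos_le_one ((hxb.trans ha)) (hxb.trans hb) hc

/-! ## Box sums under a verified height -/

/-- Two-sided form of `RiemannHypothesisUpTo T`: a zero `s` of `ζ` with `0 < |Im s| ≤ T` has
`Re s = 1/2` (for `Im s < 0` apply the hypothesis to `s̄`, a zero by `riemannZeta_conj`). [folklore] -/
private theorem re_eq_half_of_riemannHypothesisUpTo {T : ℝ} (hRH : DiophantineGeometry.RiemannHypothesisUpTo T)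
    {s : ℂ} (hs : riemannZeta s = 0) (him : s.im ≠ 0) (hT : |s.im| ≤ T) : s.re = 1 / 2 := by
  rcases lt_or_gt_of_ne him with hneg | hpos
  · have hs' : riemannZeta (conj s) = 0 := by rw [riemannZeta_conj, hs, map_zero]
    have h := hRH (conj s) hs' (by simpa using hneg)
      (by rw [Complex.conj_im, ← abs_of_neg hneg]; exact hT)
    simpa using h
  · exact hRH s hs hpos (by rwa [abs_of_pos hpos] at hT)

/-- The boxes `liZeroBox T` are stable under the reflection `ρ ↦ 1 − ρ̄` (functional equation and
conjugation: `m(1 − ρ̄) = m(ρ) > 0`, `riemannZetaZeroOrder_one_sub_conj`; a zero off the real axis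
has `0 < Re ρ < 1`). [folklore] -/
private theorem one_sub_conj_mem_liZeroBox {T : ℝ} {ρ : ℂ} (hρ : ρ ∈ liZeroBox T) :
    1 - conj ρ ∈ liZeroBox T := by
  obtain ⟨hz, h0, h1, him, hT⟩ := hρ
  have him0 : ρ.im ≠ 0 := abs_pos.1 him
  have hρ1 : ρ ≠ 1 := fun h ↦ him0 (by simp [h])
  have hre_pos : 0 < ρ.re := DiophantineGeometry.re_pos_of_riemannZeta_eq_zero hz him0
  have hre_lt : ρ.re < 1 :=
    lt_of_le_of_ne h1 fun h ↦ riemannZeta_ne_zero_of_one_le_re (le_of_eq h.symm) hz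
  have h1' : (1 : ℂ) - conj ρ ≠ 1 := by
    intro h
    apply him0
    have h' := congrArg Complex.im h
    simpa using h'
  have hm : 0 < riemannZetaZeroOrder (1 - conj ρ) := by
    rw [riemannZetaZeroOrder_one_sub_conj hre_pos hre_lt]
    exact (riemannZetaZeroOrder_pos_iff hρ1).2 hz
  refine ⟨(riemannZetaZeroOrder_pos_iff h1').1 hm, ?_, ?_, ?_, ?_⟩
  · simp only [sub_re, one_re, conj_re]; linarith
  · simp only [sub_re, one_re, conj_re]; linarith
  · simpa using him
  · simpa using hT

/-- **Non-negativity of the box sums.** If RH holds up to height `T` and `n ≤ 2π(T − 4)`, then for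
every `T'` the real part of the box sum `∑_{ρ ∈ liZeroBox T'} m(ρ) [1 − (1 − 1/ρ)ⁿ]` is `≥ 0`:
symmetrise the sum under `ρ ↦ 1 − ρ̄` (`one_sub_conj_mem_liZeroBox`) and bound each pair — zeros
with `|Im ρ| ≤ T` are on the line (`norm_one_sub_inv_eq_one`), the others obey
`re_pow_add_re_pow_reflect_le_two`. [folklore] -/
private theorem re_finsum_liZeroBox_nonneg {T : ℝ} (hRH : DiophantineGeometry.RiemannHypothesisUpTo T)
    {n : ℕ} (hnT : (n : ℝ) ≤ 2 * π * (T - 4)) (T' : ℝ) :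
    0 ≤ (∑ᶠ ρ ∈ liZeroBox T', (riemannZetaZeroOrder ρ : ℂ) * (1 - (1 - 1 / ρ) ^ n)).re := by
  classical
  rw [finsum_mem_eq_finite_toFinset_sum _ (liZeroBox_finite T'), Complex.re_sum]
  set B := (liZeroBox_finite T').toFinset with hB
  have hmem : ∀ ρ, ρ ∈ B ↔ ρ ∈ liZeroBox T' := fun ρ ↦ Set.Finite.mem_toFinset _
  set f : ℂ → ℝ := fun ρ ↦ ((riemannZetaZeroOrder ρ : ℂ) * (1 - (1 - 1 / ρ) ^ n)).re with hf
  have hσmem : ∀ ρ ∈ B, 1 - conj ρ ∈ B :=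
    fun ρ hρ ↦ (hmem _).2 (one_sub_conj_mem_liZeroBox ((hmem ρ).1 hρ))
  have hσσ : ∀ ρ : ℂ, 1 - conj (1 - conj ρ) = ρ := fun ρ ↦ by simp
  have hreindex : ∑ ρ ∈ B, f (1 - conj ρ) = ∑ ρ ∈ B, f ρ :=
    Finset.sum_nbij' (fun ρ ↦ 1 - conj ρ) (fun ρ ↦ 1 - conj ρ) hσmem hσmem
      (fun ρ _ ↦ hσσ ρ) (fun ρ _ ↦ hσσ ρ) fun _ _ ↦ rfl
  have hpair : ∀ ρ ∈ B, 0 ≤ f ρ + f (1 - conj ρ) := by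
    intro ρ hρ
    obtain ⟨hz, h0, h1, him, -⟩ := (hmem ρ).1 hρ
    have him0 : ρ.im ≠ 0 := abs_pos.1 him
    have hρ1 : ρ ≠ 1 := fun h ↦ him0 (by simp [h])
    have hre_pos : 0 < ρ.re := DiophantineGeometry.re_pos_of_riemannZeta_eq_zero hz him0
    have hre_lt : ρ.re < 1 :=
      lt_of_le_of_ne h1 fun h ↦ riemannZeta_ne_zero_of_one_le_re (le_of_eq h.symm) hz
    have hm_eq : riemannZetaZeroOrder (1 - conj ρ) = riemannZetaZeroOrder ρ :=
      riemannZetaZeroOrder_one_sub_conj hre_pos hre_lt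
    have hm : (0 : ℝ) ≤ riemannZetaZeroOrder ρ := by
      exact_mod_cast ((riemannZetaZeroOrder_pos_iff hρ1).2 hz).le
    have hfρ : f ρ = (riemannZetaZeroOrder ρ : ℝ) * (1 - ((1 - 1 / ρ) ^ n).re) := by
      simp only [hf, Complex.mul_re, Complex.intCast_re, Complex.intCast_im, zero_mul, sub_zero,
        Complex.sub_re, Complex.one_re]
    have hfσ : f (1 - conj ρ) =
        (riemannZetaZeroOrder ρ : ℝ) * (1 - ((1 - 1 / (1 - conj ρ)) ^ n).re) := by
      simp only [hf, hm_eq, Complex.mul_re, Complex.intCast_re, Complex.intCast_im, zero_mul,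
        sub_zero, Complex.sub_re, Complex.one_re]
    rw [hfρ, hfσ, ← mul_add]
    refine mul_nonneg hm ?_
    rcases le_or_gt |ρ.im| T with hlow | hhigh
    · have hρre : ρ.re = 1 / 2 := re_eq_half_of_riemannHypothesisUpTo hRH hz him0 hlow
      have hσre : (1 - conj ρ).re = 1 / 2 := by
        simp only [sub_re, one_re, conj_re, hρre]
        norm_num
      have e1 : ((1 - 1 / ρ) ^ n).re ≤ 1 :=
        calc ((1 - 1 / ρ) ^ n).re ≤ ‖(1 - 1 / ρ) ^ n‖ := Complex.re_le_norm _
          _ = 1 := by rw [norm_pow, norm_one_sub_inv_eq_one hρre, one_pow]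
      have e2 : ((1 - 1 / (1 - conj ρ)) ^ n).re ≤ 1 :=
        calc ((1 - 1 / (1 - conj ρ)) ^ n).re ≤ ‖(1 - 1 / (1 - conj ρ)) ^ n‖ := Complex.re_le_norm _
          _ = 1 := by rw [norm_pow, norm_one_sub_inv_eq_one hσre, one_pow]
      linarith
    · have hn' : (n : ℝ) ≤ 2 * π * (|ρ.im| - 4) := by
        have h2 := mul_le_mul_of_nonneg_left hhigh.le (by positivity : (0 : ℝ) ≤ 2 * π)
        linarith
      have key := re_pow_add_re_pow_reflect_le_two h0 h1 hn'
      linarith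
  have h2 : 2 * ∑ ρ ∈ B, f ρ = ∑ ρ ∈ B, (f ρ + f (1 - conj ρ)) := by
    rw [Finset.sum_add_distrib, hreindex, two_mul]
  have hnn := Finset.sum_nonneg hpair
  show 0 ≤ ∑ ρ ∈ B, f ρ
  linarith

/-! ## The theorems -/

/-- **Partial Li positivity from a verified height** (F. Brown, *Li's criterion and zero-free
regions of L-functions*, J. Number Theory 111 (2005), Theorem 2, case `ζ`, sub-range). Brown's
Theorem 2: if all zeros of `ξ` lie in the lens `D_r`, `T = (r² − 1)^{-1/2}` — in particular
(loc. cit. §1.3) if the zeros with `|Im ρ| ≤ T` lie on the critical line — then `P_n` (`Re λₙ ≥ 0`)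
holds for `1 ≤ n ≤ 2T² log T` (`T > T₀`). Formalised here: the hypothesis in its "in particular"
form `RiemannHypothesisUpTo T` and the sub-range `1 ≤ n ≤ 2π(T − 4)` of the conclusion, with no
`T₀`; the printed proof of the remaining range `T < n ≤ 2T² log T` goes through Brown's Lemma 5,
which A. Palojärvi (Alb. J. Math. 14 (2020), §1) and A. Droll (thesis, 2012) report as incomplete,
and is NOT formalised. Proof: `λₙ` is the limit of the real parts of the box sums
(`keiperLiCoeff_eq_zero_sum_holds`, Li 1997 (1.4)), each `≥ 0` by `re_finsum_liZeroBox_nonneg`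
(termwise pair positivity). Analogous tree results for other RH criteria:
`jensenPoly_xiTaylorCoeff_splits_of_riemannHypothesisUpTo` (`4d ≤ T²`), `KatkovaPF44Proofs`
(`m + 1 ≤ πT`). [cite: BrownLiCriterion2005, Thm. 2 (case ζ, sub-range 1 ≤ n ≤ 2π(T−4))] -/
theorem keiperLiCoeff_nonneg_of_riemannHypothesisUpTo {T : ℝ}
    (hRH : DiophantineGeometry.RiemannHypothesisUpTo T) {n : ℕ} (hn : 1 ≤ n)
    (hnT : (n : ℝ) ≤ 2 * π * (T - 4)) : 0 ≤ keiperLiCoeff n := by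
  have H := (Complex.continuous_re.tendsto _).comp (keiperLiCoeff_eq_zero_sum_holds n hn)
  simp only [Complex.ofReal_re] at H
  refine ge_of_tendsto' H fun T' ↦ ?_
  simp only [Function.comp_apply]
  exact re_finsum_liZeroBox_nonneg hRH hnT T'

/-- **Corollary (Platt–Trudgian height).** Brown's Theorem 2 (sub-range form
`keiperLiCoeff_nonneg_of_riemannHypothesisUpTo`) instantiated at the named numerical hypothesis
`riemannHypothesisUpTo_platt_trudgian` (RH up to height `3 000 175 332 800`; D. Platt,
T. Trudgian, Bull. LMS 53 (2021), Thm. 1): `λₙ ≥ 0` for every `1 ≤ n ≤ 18 850 000 000 000`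
(`= 1.885 · 10¹³ ≤ 2π(3 000 175 332 800 − 4)`). The certified tables of `λₙ` in print reach
`n = 10⁵` (Johansson 2015). [cite: BrownLiCriterion2005, Thm. 2 (at the Platt–Trudgian height)] -/
theorem keiperLiCoeff_nonneg_of_plattTrudgian
    (hPT : DiophantineGeometry.riemannHypothesisUpTo_platt_trudgian) {n : ℕ} (hn : 1 ≤ n)
    (hn' : n ≤ 18850000000000) : 0 ≤ keiperLiCoeff n := by
  refine keiperLiCoeff_nonneg_of_riemannHypothesisUpTo hPT hn ?_
  have h : (n : ℝ) ≤ 18850000000000 := by exact_mod_cast hn'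
  have hπ := Real.pi_gt_d6
  linarith

end Literature.NumberTheory.LFunctions
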